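import Summits.CriticalPhenomena.PercolationContinuityZ3.Theorems.Transplant.OrthantUniquenessLink
import HarnessLib

/-!
# Links of the all-arms design, II: the crossing and the move

builds on p205010 (kernel theorem, internal audit signed; external expert review pending) — nothing in this file uses p205010.
Lane `prim-bschramm`, seat `prim-bschramm-p2` gen 17 (class C1b); helper file (`--supports stmt-CriticalPhenomena-4575 --as helper`)
for the ORTHANT uniqueness programme (Barsky–Grimmett–Newman 1991, Cor. to Thm 1.1 (iii)/(iv)).  Continues `OrthantUniquenessLink`
(the objects `linkPort`, `steepReg`, `shallowReg`, `linkEvent`, the inequalities `LinkOK`, region bounds, `P ≥ α²`).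

* **`link_crossing`** — on the link event a steep-arm vertex and a shallow-arm vertex have the same shadow `(x_i, x_0)`: pad the steep
  arm below by the phantom vertical segment `b - k e_0 → b` and the shallow arm by the phantom horizontal segment `w + σk e_i → w`; the
  padded lattice walks cross the shadow rectangle `[min(t, c+σk), max(t, c+σk)] × [b_0 - k, T]` transversally
  (`exists_common_shadow_of_crossing'`), and the meeting point lies on neither padding (shallow heights `≥ H - k > b_0`; steep
  `σ x_i < σ c`);
* **`link_move`** — for ANY step graph `K` containing the lattice steps inside the two regions and inside the bounding box of a
  steep/shallow pair with common shadow: `≤ 2dk` extra open edges inside the window join the apex to the port through open `K`-steps.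
[cite: AizenmanChayesChayesFrohlichRusso1983, §4 Lemma 4.3 (overlapping paths), Lemma 4.2 (a)] [cite: BarskyGrimmettNewman1991, Comment 6 p. 116, Cor. (iii)] -/

noncomputable section

namespace Summit.CriticalPhenomena.PercolationContinuityZ3.Theorems.Transplant

namespace OrthantUniq

open MeasureTheory Literature.Probability.Percolation Literature.Probability.LatticeModels SimpleGraph PlanarCone HSU
open scoped Classical

variable {d : ℕ} [NeZero d] {p' : unitInterval}

section Link

variable (A : ArmKit d p') {b : Site d} {i : Fin d} {σ H c T t : ℤ}

/-! ## §1 The crossing and the move -/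

/-- **The crossing.** On the link event some vertex `z_Q` of the steep arm (reached from the apex inside the steep region) and some
vertex `z_P` of the shallow arm (reached from the port inside the shallow region) have the same shadow on the `(x_i, x_0)`-plane.
Proof: pad the steep arm below by the phantom vertical segment `b - k e_0 → b` and the shallow arm by the phantom horizontal
segment `w + σ k e_i → w`; the padded walks cross the shadow rectangle `[min(t, c+σk), max(t, c+σk)] × [b_0 - k, T]`
transversally, so they share a shadow (`exists_common_shadow_of_crossing'`); the meeting point is on neither padding (the shallow
arm lives at heights `≥ H - k > b_0`, the steep arm at `σ x_i < σ c`). [cite: AizenmanChayesChayesFrohlichRusso1983, §4 Lemma 4.3 (overlapping paths)] -/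
theorem link_crossing (h : LinkOK A.k b i σ H c T t) {ω : BondConfig (Site d)} (hω : ω ∈ linkEvent A b i σ H c T t) :
    ∃ zQ zP : Site d, zQ ∈ steepReg A b i σ T ∧ zP ∈ shallowReg A b i σ H c t ∧ zQ i = zP i ∧ zQ 0 = zP 0 ∧
      (openGraph ω ⊓ withinGraph (zdGraph d) (steepReg A b i σ T)).Reachable b zQ ∧
      (openGraph ω ⊓ withinGraph (zdGraph d) (shallowReg A b i σ H c t)).Reachable (linkPort b i H c) zP := by
  obtain ⟨hw0, hwi, hrest⟩ := linkPort_coords (b := b) (H := H) (c := c) h.hi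
  obtain ⟨f1, f2, f3, f4, f5, f6, f7, f8⟩ := h.facts A
  have hi := h.hi
  have hσ := h.hσ
  set w := linkPort b i H c with hw_def
  -- the two arms
  obtain ⟨⟨zS, hzS, hS⟩, ⟨zH, hzH, hHr⟩⟩ := hω
  simp only [Set.mem_setOf_eq] at hzS hzH
  obtain ⟨Q₀⟩ := mem_openConnVia_iff.1 hS
  obtain ⟨P₀⟩ := mem_openConnVia_iff.1 hHr
  have hb_mem : b ∈ steepReg A b i σ T := apex_mem_steepReg A h
  have hw_mem : w ∈ shallowReg A b i σ H c t := port_mem_shallowReg A h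
  have hQsupp : ∀ z ∈ Q₀.support, z ∈ steepReg A b i σ T := support_subset_of_walk_within Q₀ hb_mem
  have hPsupp : ∀ z ∈ P₀.support, z ∈ shallowReg A b i σ H c t := support_subset_of_walk_within P₀ hw_mem
  let Q := Q₀.mapLe (openGraph_inf_withinGraph_le ω _)
  let P := P₀.mapLe (openGraph_inf_withinGraph_le ω _)
  -- phantom padding below the apex
  set q₀ : Site d := b + (A.k : ℤ) • Pi.single 0 (-1) with hq₀
  obtain ⟨WQ, hWQ⟩ := exists_straight_walk q₀ 0 (Or.inl rfl : (1 : ℤ) = 1 ∨ (1 : ℤ) = -1) A.k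
  have hq₀b : q₀ + (A.k : ℤ) • Pi.single (0 : Fin d) (1 : ℤ) = b := by
    ext j; by_cases hj : j = 0
    · subst hj; simp [hq₀]
    · simp [hq₀, hj]
  have hWQ_coord : ∀ z ∈ WQ.support, z i = b i ∧ b 0 - A.k ≤ z 0 ∧ z 0 ≤ b 0 := by
    intro z hz
    obtain ⟨m, hm, rfl⟩ := hWQ z hz
    have hm' : (m : ℤ) ≤ A.k := by exact_mod_cast hm
    have h0 : (q₀ + (m : ℤ) • (Pi.single 0 1 : Site d)) 0 = b 0 - A.k + m := by simp [hq₀]; ring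
    have hii : (q₀ + (m : ℤ) • (Pi.single 0 1 : Site d)) i = b i := by simp [hq₀, hi]
    refine ⟨hii, ?_, ?_⟩ <;> rw [h0] <;> omega
  -- phantom padding beyond the port
  set r₀ : Site d := w + (A.k : ℤ) • Pi.single i σ with hr₀
  have hnσ : (-σ : ℤ) = 1 ∨ (-σ : ℤ) = -1 := by rcases hσ with h1 | h1 <;> rw [h1] <;> norm_num
  obtain ⟨WP, hWP⟩ := exists_straight_walk r₀ i hnσ A.k
  have hσσ : σ * σ = 1 := by rcases hσ with h1 | h1 <;> rw [h1] <;> norm_num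
  have hr₀w : r₀ + (A.k : ℤ) • Pi.single i (-σ) = w := by
    ext j; by_cases hj : j = i
    · subst hj; simp [hr₀]
    · simp [hr₀, hj]
  have hWP_coord : ∀ z ∈ WP.support, z 0 = H ∧ σ * c ≤ σ * z i ∧ σ * z i ≤ σ * c + A.k ∧ ∀ j, j ≠ 0 → j ≠ i → z j = b j := by
    intro z hz
    obtain ⟨m, hm, rfl⟩ := hWP z hz
    have hm' : (m : ℤ) ≤ A.k := by exact_mod_cast hm
    have h0 : (r₀ + (m : ℤ) • (Pi.single i (-σ) : Site d)) 0 = H := by simp [hr₀, Ne.symm hi, hw0]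
    have hii : (r₀ + (m : ℤ) • (Pi.single i (-σ) : Site d)) i = c + (A.k - m) * σ := by simp [hr₀, hwi]; ring
    refine ⟨h0, ?_, ?_, fun j hj0 hji => ?_⟩
    · rw [hii, mul_add, show σ * ((A.k - m) * σ) = (A.k - m) * (σ * σ) by ring, hσσ]; omega
    · rw [hii, mul_add, show σ * ((A.k - m) * σ) = (A.k - m) * (σ * σ) by ring, hσσ]; omega
    · simp [hr₀, hji, hrest j hj0 hji]
  let Qfull := (WQ.copy rfl hq₀b).append Q
  let Pfull := (WP.copy rfl hr₀w).append P
  -- the rectangle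
  set L := min t (c + σ * A.k) with hL
  set R := max t (c + σ * A.k) with hR
  have hQbd : ∀ z ∈ Qfull.support, L ≤ z i ∧ z i ≤ R ∧ b 0 - A.k ≤ z 0 ∧ z 0 ≤ T := by
    intro z hz
    rcases (Walk.mem_support_append_iff _ _).1 hz with hz | hz
    · rw [Walk.support_copy] at hz
      obtain ⟨h1, h2, h3⟩ := hWQ_coord z hz
      have hin := mem_interval_of_signed (k := A.k) (t := t) (c := c) (z := z i) hσ (by rw [h1]; nlinarith [h.ht]) (by rw [h1]; nlinarith [h.ht, f7])
      exact ⟨hin.1, hin.2, h2, by omega⟩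
    · rw [Walk.support_mapLe_eq_support] at hz
      obtain ⟨s1, s2, s3, s4, -⟩ := steepReg_props A h (hQsupp z hz)
      have e1 : σ * t ≤ σ * z i := by nlinarith [h.ht]
      have e2 : σ * z i ≤ σ * c + A.k := by nlinarith
      have hin := mem_interval_of_signed hσ e1 e2
      exact ⟨hin.1, hin.2, s3, s4⟩
  have hPbd : ∀ z ∈ Pfull.support, L ≤ z i ∧ z i ≤ R ∧ b 0 - A.k ≤ z 0 ∧ z 0 ≤ T := by
    intro z hz
    rcases (Walk.mem_support_append_iff _ _).1 hz with hz | hz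
    · rw [Walk.support_copy] at hz
      obtain ⟨h1, h2, h3, -⟩ := hWP_coord z hz
      have hin := mem_interval_of_signed hσ (f6.trans h2) h3
      exact ⟨hin.1, hin.2, by omega, by omega⟩
    · rw [Walk.support_mapLe_eq_support] at hz
      obtain ⟨s1, s2, s3, s4, s5, -⟩ := shallowReg_props A h (hPsupp z hz)
      have hin := mem_interval_of_signed hσ s4 s5
      exact ⟨hin.1, hin.2, by omega, s3⟩
  have hq₀0 : q₀ 0 = b 0 - A.k := by simp [hq₀]; ring
  have hr₀i : r₀ i = c + σ * A.k := by simp [hr₀, hwi]; ring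
  have hends : (r₀ i = L ∧ zH i = R) ∨ (r₀ i = R ∧ zH i = L) := by
    rw [hr₀i, hzH, hL, hR]
    rcases hσ with h1 | h1 <;> subst h1
    · right; simp at f6; constructor
      · exact (max_eq_right (by omega)).symm
      · exact (min_eq_left (by omega)).symm
    · left; simp at f6; constructor
      · exact (min_eq_right (by omega)).symm
      · exact (max_eq_left (by omega)).symm
  obtain ⟨zPt, hzPt, zQt, hzQt, hIi, hI0⟩ := exists_common_shadow_of_crossing' hi Pfull Qfull hPbd hQbd hends hq₀0 hzS
  -- the meeting point is on neither padding
  have hzPt_ht : H - A.k ≤ zPt 0 := by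
    rcases (Walk.mem_support_append_iff _ _).1 hzPt with hz | hz
    · rw [Walk.support_copy] at hz; have := (hWP_coord zPt hz).1; omega
    · rw [Walk.support_mapLe_eq_support] at hz; exact (shallowReg_props A h (hPsupp zPt hz)).1
  have hzQt_Q : zQt ∈ Q₀.support := by
    rcases (Walk.mem_support_append_iff _ _).1 hzQt with hz | hz
    · exfalso
      rw [Walk.support_copy] at hz
      have := (hWQ_coord zQt hz).2.2; omega
    · rwa [Walk.support_mapLe_eq_support] at hz
  have hzQt_reg : zQt ∈ steepReg A b i σ T := hQsupp zQt hzQt_Q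
  have hzPt_P : zPt ∈ P₀.support := by
    rcases (Walk.mem_support_append_iff _ _).1 hzPt with hz | hz
    · exfalso
      rw [Walk.support_copy] at hz
      have h1 := (hWP_coord zPt hz).2.1
      obtain ⟨s1, s2, -⟩ := steepReg_props A h hzQt_reg
      rw [hIi] at h1
      have : σ * (zQt i - b i) = σ * zQt i - σ * b i := by ring
      rw [this] at s2
      omega
    · rwa [Walk.support_mapLe_eq_support] at hz
  exact ⟨zQt, zPt, hzQt_reg, hPsupp zPt hzPt_P, hIi.symm, hI0.symm, reachable_of_mem_support' Q₀ zQt hzQt_Q,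
    reachable_of_mem_support' P₀ zPt hzPt_P⟩

/-- **The move on the link event**: for any step graph `K` containing the lattice steps inside the two regions and inside the bounding
box of any steep/shallow pair of vertices with a common shadow, `≤ 2dk` extra open edges inside `[-M, M]^d` (the window of the regions)
join the apex to the port through open `K`-steps. [cite: AizenmanChayesChayesFrohlichRusso1983, §4 Lemma 4.3 (overlap ⇒ E_k Ξ) and Lemma 4.2 (a)] -/
theorem link_move (h : LinkOK A.k b i σ H c T t) {K : SimpleGraph (Site d)}
    (hKS : withinGraph (zdGraph d) (steepReg A b i σ T) ≤ K) (hKH : withinGraph (zdGraph d) (shallowReg A b i σ H c t) ≤ K)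
    (hKJ : ∀ x ∈ steepReg A b i σ T, ∀ y ∈ shallowReg A b i σ H c t, x i = y i → x 0 = y 0 →
      withinGraph (zdGraph d) {z | ∀ j, min (x j) (y j) ≤ z j ∧ z j ≤ max (x j) (y j)} ≤ K)
    {M : ℕ} (hM : ∀ x ∈ steepReg A b i σ T ∪ shallowReg A b i σ H c t, ∀ j, |x j| ≤ M)
    {ω : BondConfig (Site d)} (hω : ω ∈ linkEvent A b i σ H c T t) :
    ∃ F : Finset (Sym2 (Site d)), F ⊆ edgesIn (zdGraph d) (box d M) ∧ F.card ≤ d * (2 * A.k) ∧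
      ω ∪ ↑F ∈ openConnVia K b (linkPort b i H c) := by
  obtain ⟨zQ, zP, hzQ, hzP, hIi, hI0, hQr, hPr⟩ := link_crossing A h hω
  obtain ⟨-, -, -, -, hzQoff⟩ := steepReg_props A h hzQ
  obtain ⟨-, -, -, -, -, hzPoff⟩ := shallowReg_props A h hzP
  obtain ⟨F, hFc, hFs, hFr⟩ := exists_junction zQ zP
  have hdist : l1dist zQ zP ≤ d * (2 * A.k) := by
    refine l1dist_le_of_forall_le fun j => ?_
    by_cases hj0 : j = 0
    · subst hj0; rw [hI0, sub_self, abs_zero]; positivity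
    · by_cases hji : j = i
      · subst hji; rw [hIi, sub_self, abs_zero]; positivity
      · have h1 := hzQoff j hj0 hji; have h2 := hzPoff j hj0 hji
        calc |zQ j - zP j| = |(zQ j - b j) - (zP j - b j)| := by ring_nf
          _ ≤ |zQ j - b j| + |zP j - b j| := abs_sub _ _
          _ ≤ (2 * A.k : ℕ) := by push_cast; omega
  refine ⟨F, ?_, hFc.trans hdist, ?_⟩
  · intro e he
    exact edgeSet_withinGraph_subset_edgesIn (bbox_subset_boxSet (hM zQ (Or.inl hzQ)) (hM zP (Or.inr hzP))) (hFs (Finset.mem_coe.2 he))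
  · refine mem_openConnVia_iff.2 ?_
    have r1 : (openGraph (ω ∪ ↑F) ⊓ K).Reachable b zQ := reachable_of_arm hQr hKS
    have r2 : (openGraph (ω ∪ ↑F) ⊓ K).Reachable zQ zP := reachable_of_junction hFr (subset_refl F) (hKJ zQ hzQ zP hzP hIi hI0)
    have r3 : (openGraph (ω ∪ ↑F) ⊓ K).Reachable zP (linkPort b i H c) := (reachable_of_arm hPr hKH).symm
    exact r1.trans (r2.trans r3)

end Link

end OrthantUniq

end Summit.CriticalPhenomena.PercolationContinuityZ3.Theorems.Transplant

end
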